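import Literature.AnabelianGeometry.AbsoluteAnabelian.MonoidKummerMapsSub
import Literature.AnabelianGeometry.AbsoluteAnabelian.MonoidKummerMapsTLGLiftOfFiniteIndexOpen
import HarnessLib

/-!
# [AbsTopIII] Prop 3.2 (iv), the STRICTLY-BELYI `TM` bijectivity clause: the typed schema
# `GaloisIsoLiftsToTMPairIsoOfStrictlyBelyi H` holds for every compact-`Π` hypothesis predicate
# (unconditionally), for pairs of mono-analytic type, and for EVERY `H` modulo Nikolov–Segal (F-1977)

Proof-only companion (theorems only, no new definitions) of abc-iut-w4-d045's
`MonoidKummerMapsSub.lean` (S. Mochizuki, *Topics in Absolute Anabelian Geometry III*, Prop. 3.2 (iv)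
p. 72 l. 19–21: "this injection is a bijection if … [`T` is either `TM` or `TF`, and] `(Π ↷ M_T)`,
`(Π* ↷ M*_T)` are of strictly Belyi type"; kurims manuscript, lit key `paper:url-5493eb38cbb7`;
sub-DAG row P32.iv.L16 of `plan/L4/SUBDAG-AbsTopIII-Prop32.md`, recorded there as "none for the
strictly-Belyi variant").

OBSERVATION (kernel-visible): the `TM` half of the typed schema, `GaloisIsoLiftsToTMPairIsoOfStrictlyBelyi H`,
is — binder for binder — the SAME `Prop` as abc-iut-L4-t2's orbicurve-form schema
`GaloisIsoLiftsToTMPairIso H` (both ask: every admissible isomorphism of topological groups between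
MLF-Galois `TM`-pairs satisfying `H` lifts to an isomorphism of pairs); only the intended instance of `H`
differs.  Since the tree proves the `TM` lifting by the LOCAL CLASS FIELD THEORY route of the printed proof
of the orbicurve clause (p. 72 l. 50 – p. 73 l. 2: "the copy of `M_TM ⥲ 𝒪^⊳_k` embedded in abelianizations
of open subgroups of `G ⥲ G_k`") — and NOT by print's strictly-Belyi route through (iii) / Cor. 1.10 (h),
which the tree does not have — every theorem about `GaloisIsoLiftsToTMPairIso H` transfers verbatim:

* `galoisIsoLiftsToTMPairIsoOfStrictlyBelyi_iff` — the two schemata coincide (`Iff.rfl`);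
* `galoisIsoLiftsToTMPairIsoOfStrictlyBelyi_of_compact_holds` — UNCONDITIONAL for every `H` under which
  `Π` is compact (the intended instance: the profinite `π₁` of a curve of strictly Belyi type), from this
  seat's `galoisIsoLiftsToTMPairIso_of_compact_holds`;
* `galoisIsoLiftsToTMPairIsoOfStrictlyBelyi_monoAnalytic_holds` — UNCONDITIONAL at
  `H := IsOfMonoAnalyticTypeMonoid TM` (F-0410 `galoisIsoLiftsToTMPairIsoOfMonoAnalytic_holds`);
* `galoisIsoLiftsToTMPairIsoOfStrictlyBelyi_of_tlgLifting` — for every `H`, from the one `TLG` lifting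
  sentence (abc-iut-L6-t21's `galoisIsoLiftsToTMPairIso_of_tlgLifting`);
* `galoisIsoLiftsToTMPairIsoOfStrictlyBelyi_of_finiteIndexOpenOfTopFG_of_localEPC` — for EVERY `H`,
  modulo the Nikolov–Segal fact BY NAME (`Rmk253.FiniteIndexOpenOfTopFG`, FACT-LIST F-1977) and Tate's
  local Euler–Poincaré characteristic (discharged Summits-side).

HONEST FRAMING: this says the strictly-Belyi HYPOTHESIS IS IDLE for the `TM` clause AS TYPED (existence of
a lift); it is NOT idle for the `TF` clause `GaloisIsoLiftsToTFPairIsoOfStrictlyBelyi` (an equivariant FIELD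
isomorphism `k̄ ⥲ k̄*` over an arbitrary `Π ⥲ Π*` is false for bare MLF data — Jarden–Ritter / Yamagata —
and is exactly where [Mzk20] Thm. 2.6 (v) / Cor. 1.10 (h) enter), which this file does not touch.  OUR
kernel check of classical reductions; a FACT consumed by name is an assumption label; nothing here bears
on [IUTchIII] Cor. 3.12 or asserts anything about abc.
-/

noncomputable section

namespace Literature.AnabelianGeometry.AbsoluteAnabelian

open Literature.NumberTheory.GaloisRepresentations (localEulerPoincareCharacteristic)
open Literature.IUT.HodgeTheaters.Rmk253 (FiniteIndexOpenOfTopFG)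

/-- The strictly-Belyi `TM` schema and the orbicurve-form `TM` schema of [AbsTopIII] Prop. 3.2 (iv) are
the same `Prop` for every hypothesis predicate `H` (they differ only in the intended `H`).
[cite: MochizukiAbsTopIII2015, Proposition 3.2 (iv) p.72] -/
theorem galoisIsoLiftsToTMPairIsoOfStrictlyBelyi_iff (H : GaloisMonoidPair.{0} → Prop) :
    GaloisIsoLiftsToTMPairIsoOfStrictlyBelyi H ↔ GaloisIsoLiftsToTMPairIso H :=
  Iff.rfl

/-- **Prop. 3.2 (iv), strictly-Belyi `TM` bijectivity, UNCONDITIONAL for compact `Π`**: the schema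
`GaloisIsoLiftsToTMPairIsoOfStrictlyBelyi H` holds for every hypothesis predicate `H` under which `Π` is
compact (e.g. the profinite `π₁` of a curve of strictly Belyi type) — by the local class field theory
route (`galoisIsoLiftsToTMPairIso_of_compact_holds`). [cite: MochizukiAbsTopIII2015, Proposition 3.2 (iv) p.72] -/
theorem galoisIsoLiftsToTMPairIsoOfStrictlyBelyi_of_compact_holds (H : GaloisMonoidPair.{0} → Prop)
    (hH : ∀ P, H P → CompactSpace P.Pi) :
    Literature.AnabelianGeometry.AbsoluteAnabelian.GaloisIsoLiftsToTMPairIsoOfStrictlyBelyi H :=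
  galoisIsoLiftsToTMPairIso_of_compact_holds H hH

/-- **Prop. 3.2 (iv), strictly-Belyi `TM` bijectivity at pairs of mono-analytic type, UNCONDITIONAL**
(F-0410 `galoisIsoLiftsToTMPairIsoOfMonoAnalytic_holds`; the admissibility binder is not even needed).
[cite: MochizukiAbsTopIII2015, Proposition 3.2 (iv) p.72] [cite: Mochizuki2012, II Rmk 1.11.1 (i) p.50] -/
theorem galoisIsoLiftsToTMPairIsoOfStrictlyBelyi_monoAnalytic_holds :
    Literature.AnabelianGeometry.AbsoluteAnabelian.GaloisIsoLiftsToTMPairIsoOfStrictlyBelyi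
      (IsOfMonoAnalyticTypeMonoid .TM) :=
  fun P Q hP hQ hPm hQm f _ => galoisIsoLiftsToTMPairIsoOfMonoAnalytic_holds P Q hP hQ hPm hQm f

/-- **Prop. 3.2 (iv), strictly-Belyi `TM` bijectivity for EVERY `H`, from the one `TLG` lifting
sentence** (abc-iut-L6-t21's `galoisIsoLiftsToTMPairIso_of_tlgLifting`).
[cite: MochizukiAbsTopIII2015, Proposition 3.2 (iv) p.72] -/
theorem galoisIsoLiftsToTMPairIsoOfStrictlyBelyi_of_tlgLifting (H : GaloisMonoidPair.{0} → Prop)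
    (hlift : ∀ (P Q : GaloisMonoidPair.{0}), IsMLFGaloisMonoidPair .TLG P →
      IsMLFGaloisMonoidPair .TLG Q → ∀ f : P.Pi ≃ₜ* Q.Pi,
        P.actionKer.map f.toMulEquiv.toMonoidHom = Q.actionKer →
          ∃ e : GaloisMonoidPair.Iso P Q, e.isoPi = f) :
    Literature.AnabelianGeometry.AbsoluteAnabelian.GaloisIsoLiftsToTMPairIsoOfStrictlyBelyi H :=
  galoisIsoLiftsToTMPairIso_of_tlgLifting H hlift

/-- **Prop. 3.2 (iv), strictly-Belyi `TM` bijectivity for EVERY `H`, modulo Nikolov–Segal BY NAME**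
(`Rmk253.FiniteIndexOpenOfTopFG`, FACT-LIST F-1977) and Tate's local Euler–Poincaré characteristic
(`hEP`, discharged Summits-side). [cite: MochizukiAbsTopIII2015, Proposition 3.2 (iv) p.72]
[cite: Mochizuki2012, IUTchI Rmk 2.5.3 (vi) (O3) p.56] -/
theorem galoisIsoLiftsToTMPairIsoOfStrictlyBelyi_of_finiteIndexOpenOfTopFG_of_localEPC
    (hNS : FiniteIndexOpenOfTopFG.{0})
    (hEP : ∀ (F : Type) [Field F] [ValuativeRel F] [TopologicalSpace F] [IsNonarchimedeanLocalField F]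
      [CharZero F], localEulerPoincareCharacteristic F)
    (H : GaloisMonoidPair.{0} → Prop) :
    Literature.AnabelianGeometry.AbsoluteAnabelian.GaloisIsoLiftsToTMPairIsoOfStrictlyBelyi H :=
  galoisIsoLiftsToTMPairIso_of_finiteIndexOpenOfTopFG_of_localEPC hNS hEP H

end Literature.AnabelianGeometry.AbsoluteAnabelian

end
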